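import Summits.ResolutionOfSingularities.ResolutionOfSingularities.Theorems.WildQuotientsSummitReductionStubPairQuasiSplitNormalFormLemmas3
import Summits.ResolutionOfSingularities.ResolutionOfSingularities.Theorems.WildQuotientsSummitReductionStubPairQuasiSplitNormalFormLemmas7
import HarnessLib

/-!
# `WildQuotients.SummitReduction` (stmt-ResolutionOfSingularities-16324), line `FramePerfect`, skeleton v8:
# stub `stub_pair_quasiSplitNormalForm` (N) — helper file 10: de Jong 1996, 3.5 [B5] on complete local
# rings for a QUASI-SPLIT semi-stable pair over an arbitrary field ("Each `Eᵢ` maps … to an irreducible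
# component of some `Dᵢ ∩ Dⱼ` … hence `Eᵢ` is a regular scheme")

Route `ResolutionOfSingularities/WildQuotients`, crux `SummitReduction`; sub-goals of the registered
stub `stub_pair_quasiSplitNormalForm` of the line skeleton `Cruxes/SummitReduction/Lines/FramePerfect.lean`
(v8, lead c4). Worker file.

The tree proves de Jong 1996, 3.5 [B5] read on complete local rings
(`DeJong1996CodimThreeSingularComponentsFormal.of_splitNodal_of_polynomial`,
`AlterationsSingularComponentsProofs.lean`): at a closed point `x` of a component `E` of `Sing(X)`,
`(𝒪_{E,x})^ ≅ 𝒪̂_{Y,f x}/(t_a, t_b)`, over an ALGEBRAICALLY CLOSED field. Its three cores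
(`core_minimalPrimes`, `core_map_eq`, `core_bijective`) are general; algebraic closedness enters
through the split nodal structure, "`nᵢ ∈ {0, 1}`" and the equality of the residue fields of `x` and
`f x`. This file re-runs the assembly on the quasi-split nodal structure of `…Lemmas3.lean`,
`exponent_le_one_of_codimThree` of `…Lemmas7.lean` and `exists_sub_mem_maximalIdeal_of_quasiSplit`
(the quasi-split datum forces equal residue fields, so no closedness of `x` is needed), for an
ARBITRARY regular system of parameters of `𝒪_{Y,f x}` adapted to `D`, and records the intrinsic trace
of the pair `(a, b)` on `𝒪_{X,x}` needed by the equivariant version (de Jong 1997, 5.11 ¶2):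
`f^#(tᵢ) ∈ I_{E,x}` iff `i ∈ {a, b}`.

* `exists_pair_of_component_of_quasiSplit` — [B5] formal at a point of a component `E` of
  `Sing(X)` carrying a quasi-split datum: the pair `a ≠ b`, the trace, and
  `(𝒪_{E,x})^ ≅ 𝒪̂_{Y,f x}/(t_a, t_b)` compatibly with `𝒪_{Y,f x} → 𝒪_{X,x} → 𝒪_{E,x}`;
* `isRegularLocalRing_quotient_component_of_quasiSplit` — "hence `Eᵢ` is a regular scheme" at such
  a point: `𝒪_{X,x}/I_{E,x}` is a regular local ring.
-/

set_option linter.dupNamespace false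

noncomputable section

open CategoryTheory CategoryTheory.Limits AlgebraicGeometry TopologicalSpace Topology
open Literature.AlgebraicGeometry.Resolution
open Literature.AlgebraicGeometry
open IsLocalRing Scheme.IdealSheafData DeJong1996 DeJong1996.FormalNodeRing

namespace Summit.ResolutionOfSingularities.ResolutionOfSingularities.Theorems

universe u

/-! ## [B5] on complete local rings at a closed point of a component of `Sing(X)` -/

/-- **de Jong 1996, 3.5 [B5] read on complete local rings, for a QUASI-SPLIT semi-stable pair with
`codim(Sing X, X) ≥ 3` over an arbitrary field.** For a pair in Situation 4.23, an irreducible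
component `E` of `Sing(X) = {x | 𝒪_{X,x} not regular}`, a point `x ∈ Ē` carrying a quasi-split
datum (e.g. a closed point), and ANY regular system of parameters `t₁, …, t_r, s₁, …, s_e` of `𝒪_{Y,f x}` with
`I(D)_{f x} = (t₁ ⋯ t_r)`: there are indices `a ≠ b` such that `f^#(tᵢ) ∈ I_{E,x}` iff
`i ∈ {a, b}`, and an isomorphism `(𝒪_{E,x})^ ≅ 𝒪̂_{Y,f x}/(t_a, t_b)` compatible with
`𝒪_{Y,f x} → 𝒪_{X,x} → 𝒪_{E,x}` ("Each `Eᵢ` maps in a finite étale manner to an irreducible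
component of some `Dᵢ ∩ Dⱼ`", formally at `x`). The tree's `of_splitNodal_of_polynomial` verbatim
on the quasi-split nodal structure (`exists_formalNodeRing_equiv_of_quasiSplit`), with
`exponent_le_one_of_codimThree`, the G-ring property of `𝒪_{X,x}` (Mizutani's
`Matsumura1987_32_polynomial_holds`) and the equality of residue fields forced by the datum
(`exists_sub_mem_maximalIdeal_of_quasiSplit`). [cite: DeJong1996, 3.5, p. 64]
[cite: DeJong1997, proof of Prop. 5.11, p. 619] -/
theorem exists_pair_of_component_of_quasiSplit {k : Type u} [Field k] {X Y : Scheme.{u}}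
    {f : X ⟶ Y} {g : Y ⟶ Spec (.of k)} {D : Set Y} {n : ℕ} {τ : Fin n → (Y ⟶ X)}
    (hS : DeJong1996.SemiStablePair f g D τ)
    (hcodim : ∀ x : X, ¬ IsRegularLocalRing (X.presheaf.stalk x) →
      (3 : WithBot ℕ∞) ≤ ringKrullDim (X.presheaf.stalk x))
    (hSc : IsClosed ({x : X | ¬ IsRegularLocalRing (X.presheaf.stalk x)} : Set X))
    {E : Set ↥({x : X | ¬ IsRegularLocalRing (X.presheaf.stalk x)} : Set X)}
    (hE : E ∈ irreducibleComponents ↥({x : X | ¬ IsRegularLocalRing (X.presheaf.stalk x)} : Set X))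
    {x : X} (hxE : x ∈ closure (Subtype.val '' E))
    (e₁ : AdicCompletion
        ((maximalIdeal (X.presheaf.stalk x)).map (Ideal.Quotient.mk
          ((maximalIdeal (Y.presheaf.stalk (f x))).map (f.stalkMap x).hom)))
        (X.presheaf.stalk x ⧸ (maximalIdeal (Y.presheaf.stalk (f x))).map (f.stalkMap x).hom) ≃+*
      MvPowerSeries (Fin 2) (Y.presheaf.stalk (f x) ⧸ maximalIdeal (Y.presheaf.stalk (f x))) ⧸
        Ideal.span {(MvPowerSeries.X 0 * MvPowerSeries.X 1 :
          MvPowerSeries (Fin 2) (Y.presheaf.stalk (f x) ⧸ maximalIdeal (Y.presheaf.stalk (f x))))})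
    (he₁ : e₁.toRingHom.comp ((algebraMap (X.presheaf.stalk x ⧸
        (maximalIdeal (Y.presheaf.stalk (f x))).map (f.stalkMap x).hom) _).comp
        (Ideal.quotientMap ((maximalIdeal (Y.presheaf.stalk (f x))).map (f.stalkMap x).hom)
          (f.stalkMap x).hom Ideal.le_comap_map)) =
      algebraMap (Y.presheaf.stalk (f x) ⧸ maximalIdeal (Y.presheaf.stalk (f x))) _)
    {r e₀ : ℕ} (t : Fin r → Y.presheaf.stalk (f x)) (s : Fin e₀ → Y.presheaf.stalk (f x))
    (hdimA : ringKrullDim (Y.presheaf.stalk (f x)) = (r + e₀ : ℕ))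
    (hspanA : Ideal.span (Set.range t ∪ Set.range s) = maximalIdeal (Y.presheaf.stalk (f x)))
    (hIA : stalkIdeal (vanishingIdeal ⟨D, hS.isStrictNormalCrossingsDivisor.isClosed⟩) (f x) =
      Ideal.span {∏ i, t i}) :
    ∃ a b : Fin r, a ≠ b ∧
      (∀ i : Fin r, (f.stalkMap x).hom (t i) ∈ stalkIdeal (singularComponentIdeal E) x ↔
        i = a ∨ i = b) ∧
      ∃ φ : CompletedQuotient (X.presheaf.stalk x) (stalkIdeal (singularComponentIdeal E) x) ≃+*
          CompletedBranchRing (Y.presheaf.stalk (f x)) (t a) (t b),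
        ∀ c : Y.presheaf.stalk (f x),
          φ (CompletedQuotient.mk _ _ ((f.stalkMap x).hom c)) =
            CompletedBranchRing.mk _ (t a) (t b) c := by
  classical
  haveI := hS.isIntegral
  haveI := hS.locallyOfFiniteType
  haveI := hS.isNoetherian
  haveI := hS.isRegular_base (f x)
  -- the residue fields of `x` and `f x` agree (quasi-split datum)
  have hres : ∀ r : X.presheaf.stalk x, ∃ c : Y.presheaf.stalk (f x),
      (f.stalkMap x).hom c - r ∈ maximalIdeal (X.presheaf.stalk x) := by
    intro r
    obtain ⟨c, hc⟩ := exists_sub_mem_maximalIdeal_of_quasiSplit (f.stalkMap x).hom e₁ he₁ r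
    refine ⟨c, ?_⟩
    rw [← neg_sub]
    exact Submodule.neg_mem _ hc
  -- the parameters on one index set
  set m := r + e₀ with hm
  set w : Fin m → Y.presheaf.stalk (f x) := Fin.append t s with hw
  have hspanW : Ideal.span (Set.range w) = maximalIdeal (Y.presheaf.stalk (f x)) := by
    rw [hw, range_fin_append, hspanA]
  have hIW : stalkIdeal (vanishingIdeal ⟨D, hS.isStrictNormalCrossingsDivisor.isClosed⟩) (f x) =
      Ideal.span {∏ i ∈ Finset.univ.filter (fun i : Fin m => i.val < r), w i} := by
    rw [hIA, hw, Fin.prod_filter_lt_append]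
  -- the quasi-split nodal structure and `νᵢ ≤ 1`
  obtain ⟨ν, e, hν, he⟩ := exists_formalNodeRing_equiv_of_quasiSplit hS e₁ he₁ w hspanW hdimA hIW
  clear he₁ e₁
  have hν1 : ∀ i, ν i ≤ 1 := fun i => exponent_le_one_of_codimThree hS hcodim e i
  -- `𝒪_{X,x}` is a G-ring; `P = I_{E,x}` is a minimal non-regular prime
  have hG : IsGRing (X.presheaf.stalk x) :=
    isGRing_stalk_of_polynomial Matsumura1987_32_polynomial_holds (f ≫ g) x
  obtain ⟨hPp, hPreg, hPmin⟩ := stalkIdeal_vanishingIdeal_component hSc hE hxE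
  set P := stalkIdeal (singularComponentIdeal E) x with hP
  haveI : P.IsPrime := hPp
  -- Steps 1–2: `P R̂ = e⁻¹(u, v, T_a, T_b)`
  obtain ⟨a, b, hab, ha, hb, hta, htb, hPJ⟩ :=
    core_map_eq hG hν1 e (fun i => (f.stalkMap x).hom (w i)) he P hPreg hPmin
  have ha0 : ν a ≠ 0 := by rw [ha]; exact one_ne_zero
  have hb0 : ν b ≠ 0 := by rw [hb]; exact one_ne_zero
  -- `a, b < r` (the exponents vanish beyond `r`)
  have haρ : a.val < r := by
    by_contra h
    exact ha0 (hν a (not_lt.mp h))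
  have hbρ : b.val < r := by
    by_contra h
    exact hb0 (hν b (not_lt.mp h))
  set a' : Fin r := ⟨a.val, haρ⟩ with ha'
  set b' : Fin r := ⟨b.val, hbρ⟩ with hb'
  have hcast : ∀ i : Fin r, w (Fin.castAdd e₀ i) = t i := fun i => by rw [hw, Fin.append_left]
  have haa : a = Fin.castAdd e₀ a' := Fin.ext rfl
  have hbb : b = Fin.castAdd e₀ b' := Fin.ext rfl
  have hwa : w a = t a' := by rw [haa, hcast]
  have hwb : w b = t b' := by rw [hbb, hcast]
  have ha'b' : a' ≠ b' := fun h => hab (Fin.ext (by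
    have := congrArg Fin.val h
    simpa [ha', hb'] using this))
  -- the trace `f^#(tᵢ) ∈ P ↔ i ∈ {a', b'}`
  have htrace : ∀ i : Fin r, (f.stalkMap x).hom (t i) ∈ P ↔ i = a' ∨ i = b' := by
    intro i
    have h1 := mem_iff_of_map_eq_comap_singPrime e (fun i => (f.stalkMap x).hom (w i)) he hab ha0 hb0
      hPJ (Fin.castAdd e₀ i)
    dsimp only at h1
    rw [hcast] at h1
    rw [h1, haa, hbb]
    constructor
    · rintro (h | h)
      · exact Or.inl (Fin.castAdd_injective _ _ h)
      · exact Or.inr (Fin.castAdd_injective _ _ h)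
    · rintro (rfl | rfl)
      · exact Or.inl rfl
      · exact Or.inr rfl
  -- Step 3: `Â/(t_a, t_b) ≅ R̂/P R̂` (the residue fields agree by the quasi-split datum)
  obtain ⟨θ, hθ, hsurj, hker⟩ :=
    core_bijective e (f.stalkMap x).hom w hspanW hdimA he hres P hab ha0 hb0 hta htb hPJ
  rw [hwa, hwb] at hker
  -- the isomorphism and its compatibility
  let θ' := RingHom.quotientKerEquivOfSurjective hsurj
  let ι₁ : CompletedBranchRing (Y.presheaf.stalk (f x)) (t a') (t b') ≃+*
      (AdicCompletion (maximalIdeal (Y.presheaf.stalk (f x))) (Y.presheaf.stalk (f x)) ⧸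
        RingHom.ker θ) :=
    Ideal.quotEquivOfEq hker.symm
  let ι₂ : CompletedQuotient (X.presheaf.stalk x) P ≃+*
      (AdicCompletion (maximalIdeal (X.presheaf.stalk x)) (X.presheaf.stalk x) ⧸
        P.map (algebraMap (X.presheaf.stalk x)
          (AdicCompletion (maximalIdeal (X.presheaf.stalk x)) (X.presheaf.stalk x)))) :=
    (quotientCompletionEquiv (maximalIdeal (X.presheaf.stalk x)) P).symm
  refine ⟨a', b', ha'b', htrace, ι₂.trans (ι₁.trans θ').symm, fun c => ?_⟩
  have h1 : (ι₁.trans θ') (CompletedBranchRing.mk (Y.presheaf.stalk (f x)) (t a') (t b') c) =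
      Ideal.Quotient.mk _ (algebraMap (X.presheaf.stalk x)
        (AdicCompletion (maximalIdeal (X.presheaf.stalk x)) (X.presheaf.stalk x))
          ((f.stalkMap x).hom c)) := by
    rw [← hθ c]
    rfl
  have h2 : ι₂ (CompletedQuotient.mk (X.presheaf.stalk x) P ((f.stalkMap x).hom c)) =
      Ideal.Quotient.mk _ (algebraMap (X.presheaf.stalk x)
        (AdicCompletion (maximalIdeal (X.presheaf.stalk x)) (X.presheaf.stalk x))
          ((f.stalkMap x).hom c)) := by
    rw [RingEquiv.symm_apply_eq, CompletedQuotient.mk_apply,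
      AdicCompletion.algebraMap_apply (maximalIdeal (X.presheaf.stalk x)) ((f.stalkMap x).hom c),
      Algebra.algebraMap_self, RingHom.id_apply, quotientCompletionEquiv_mk_of,
      AdicCompletion.algebraMap_apply ((maximalIdeal (X.presheaf.stalk x)).map (Ideal.Quotient.mk P))
        (Ideal.Quotient.mk P ((f.stalkMap x).hom c)), Algebra.algebraMap_self, RingHom.id_apply]
  rw [RingEquiv.trans_apply, RingEquiv.symm_apply_eq, h1, h2]

/-- **"hence `Eᵢ` is a regular scheme" at a closed point, over an arbitrary field**: for a
quasi-split semi-stable pair with `codim(Sing X, X) ≥ 3`, an irreducible component `E` of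
`Sing(X)` and a point `x ∈ Ē` carrying a quasi-split datum, the local ring
`𝒪_{E,x} = 𝒪_{X,x}/I_{E,x}` of the reduced `E` is regular: its completion is
`𝒪̂_{Y,f x}/(t_a, t_b)` (`exists_pair_of_component_of_quasiSplit`), regular as the quotient of the
regular `𝒪̂_{Y,f x}` by part of a regular system of parameters, and regularity descends from the
completion. [cite: DeJong1996, 3.5, p. 64] -/
theorem isRegularLocalRing_quotient_component_of_quasiSplit {k : Type u} [Field k]
    {X Y : Scheme.{u}} {f : X ⟶ Y} {g : Y ⟶ Spec (.of k)} {D : Set Y} {n : ℕ} {τ : Fin n → (Y ⟶ X)}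
    (hS : DeJong1996.SemiStablePair f g D τ)
    (hcodim : ∀ x : X, ¬ IsRegularLocalRing (X.presheaf.stalk x) →
      (3 : WithBot ℕ∞) ≤ ringKrullDim (X.presheaf.stalk x))
    (hSc : IsClosed ({x : X | ¬ IsRegularLocalRing (X.presheaf.stalk x)} : Set X))
    {E : Set ↥({x : X | ¬ IsRegularLocalRing (X.presheaf.stalk x)} : Set X)}
    (hE : E ∈ irreducibleComponents ↥({x : X | ¬ IsRegularLocalRing (X.presheaf.stalk x)} : Set X))
    {x : X} (hxE : x ∈ closure (Subtype.val '' E))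
    (e₁ : AdicCompletion
        ((maximalIdeal (X.presheaf.stalk x)).map (Ideal.Quotient.mk
          ((maximalIdeal (Y.presheaf.stalk (f x))).map (f.stalkMap x).hom)))
        (X.presheaf.stalk x ⧸ (maximalIdeal (Y.presheaf.stalk (f x))).map (f.stalkMap x).hom) ≃+*
      MvPowerSeries (Fin 2) (Y.presheaf.stalk (f x) ⧸ maximalIdeal (Y.presheaf.stalk (f x))) ⧸
        Ideal.span {(MvPowerSeries.X 0 * MvPowerSeries.X 1 :
          MvPowerSeries (Fin 2) (Y.presheaf.stalk (f x) ⧸ maximalIdeal (Y.presheaf.stalk (f x))))})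
    (he₁ : e₁.toRingHom.comp ((algebraMap (X.presheaf.stalk x ⧸
        (maximalIdeal (Y.presheaf.stalk (f x))).map (f.stalkMap x).hom) _).comp
        (Ideal.quotientMap ((maximalIdeal (Y.presheaf.stalk (f x))).map (f.stalkMap x).hom)
          (f.stalkMap x).hom Ideal.le_comap_map)) =
      algebraMap (Y.presheaf.stalk (f x) ⧸ maximalIdeal (Y.presheaf.stalk (f x))) _) :
    IsRegularLocalRing (X.presheaf.stalk x ⧸ stalkIdeal (singularComponentIdeal E) x) := by
  haveI := hS.isIntegral
  haveI := hS.isNoetherian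
  -- a regular system of parameters of `𝒪_{Y,f x}` adapted to `D`
  obtain ⟨r, e₀, t, s, hdimA, hspanA, hIA, -⟩ := hS.exists_rsop_stalkIdeal_base (f x)
  obtain ⟨a, b, -, -, φ, -⟩ :=
    exists_pair_of_component_of_quasiSplit hS hcodim hSc hE hxE e₁ he₁ t s hdimA hspanA hIA
  clear he₁ e₁
  haveI := hS.isRegular_base (f x)
  haveI := isRegularLocalRing_adicCompletion_quotient_span_pair t s hdimA hspanA a b
  set R := X.presheaf.stalk x with hR
  set P := stalkIdeal (singularComponentIdeal E) x with hP
  have hxsupp : x ∈ (singularComponentIdeal E).support := by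
    rw [← SetLike.mem_coe, coe_support_singularComponentIdeal]
    exact hxE
  have hPle : P ≤ maximalIdeal R := (mem_support_iff_stalkIdeal_le _ x).mp hxsupp
  haveI : Nontrivial (R ⧸ P) :=
    Ideal.Quotient.nontrivial_iff.mpr fun h =>
      (maximalIdeal.isMaximal R).ne_top (top_le_iff.mp (h ▸ hPle))
  haveI : IsLocalRing (R ⧸ P) :=
    IsLocalRing.of_surjective' (Ideal.Quotient.mk P) Ideal.Quotient.mk_surjective
  have hI : (maximalIdeal R).map (Ideal.Quotient.mk P) = maximalIdeal (R ⧸ P) :=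
    (maximalIdeal_quotient_eq_map P).symm
  exact isRegularLocalRing_of_adicCompletion_equiv hI φ

end Summit.ResolutionOfSingularities.ResolutionOfSingularities.Theorems

end
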